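import Summits.ValiantsHypothesis.ValiantsHypothesis.Theorems.SymPencilPerFourPeeledCornerSwap

/-!
# Route `SymPencil` — `2 | 2` inner rank of `per_4`, PEELED case at `≤ 11` squares: the
# DOUBLE-SWAP CORNER on two DIFFERENT pairs — the twelve independent vectors (`--supports`
# stmt-ValiantsHypothesis-5674 `SdcSuperquadratic`; (8,8) column, cell (8,8,11); memo
# `NOTE-p6g16-5674-corner-double-swap.md` §1 "different pairs: dead by counting"; rung currency only)

Abstract linear algebra of memo §1, in the `N/M` currency of
`…CornerSwapSamePair.linearIndependent_eleven`: vectors `N b y, M a z, v₀, v₀'` in `K^κ` with weights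
`c`, cross pairings `⟨M_az, N_by⟩ = ½[a,b,y,z distinct] − ρ·S₀₁[a,y]·S_kl[b,z]·λ` (the double-swap
corner `ψ = u₀S₀₁`, `ψ' = u₁S_kl`, `ρ = u₀u₁`, `λ = ⟨v₀,v₀'⟩`), `N ⟂ v₀, v₀'`, `M ⟂ v₀, v₀'`, `v₀, v₀'`
isotropic, `ρλ ≠ 0`.  For the two representative different pairs:

* `linearIndependent_twelve_swap23` (`{k,l} = {2,3}`, disjoint from `{0,1}`): the ten `N`'s
  `N₂₀,N₀₂,N₂₁,N₁₂,N₃₀,N₀₃,N₃₁,N₁₃,N₀₁,N₂₃` with `v₀, v₀'` are linearly independent — the pairing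
  matrix against `M₁₃,M₃₁,M₀₃,M₃₀,M₁₂,M₂₁,M₀₂,M₂₀,M₂₃,M₀₁,v₀',v₀` is block diagonal with four blocks
  `[[½ − ρλ, ½],[½, ½]]` (determinant `−ρλ/4`) and entries `½, ½, λ, λ`;
* `linearIndependent_twelve_swap02` (`{k,l} = {0,2}`, adjacent): the ten `N`'s
  `N₀₀,N₂₁,N₀₁,N₂₀,N₁₀,N₀₂,N₀₃,N₁₂,N₁₃,N₂₃` with `v₀, v₀'` — a triangular pattern with pivots
  `−ρλ` (×4) and `½` (×6).

So `12 ≤ |κ|`; the family-level contradiction at `|κ| ≤ 11` is drawn in `…CornerSwapPairs`.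
Honest framing: corner bookkeeping; no cell closes; `28 ≤ sdc(per_4) ≤ 29` of record, the crux
`SdcSuperquadratic` and `VP ≠ VNP` untouched.  No definitions, no named facts. [folklore]
-/

noncomputable section

-- single-conjunct layout: Sub = Summit, duplicated namespace component intended
set_option linter.dupNamespace false

namespace Summit.ValiantsHypothesis.ValiantsHypothesis.Theorems.SymPencilPerFourPeeledCornerSwapPairsVectors

open Matrix Finset Module

universe u v

variable {K : Type u} [Field K]

/-- **Twelve independent vectors** for the corner `ψ = u₀·S₀₁`, `ψ' = u₁·S_{23}`
(memo §1): the ten `N`'s `N20, N02, N21, N12, N30, N03, N31, N13, N01, N23` together with `v₀, v₀'`, by the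
pairing pattern against the `M`'s, `v₀'` and `v₀` (cross pairings `½[a,b,y,z distinct] − ρ·S₀₁[a,y]·S_{23}[b,z]·λ`).
[folklore] -/
theorem linearIndependent_twelve_swap23 [CharZero K] {κ : Type v} [Fintype κ] [DecidableEq κ]
    (c : κ → K) (N M : Fin 4 → Fin 4 → κ → K) (v₀ v₀' : κ → K) (ρ lam : K)
    (hMN : ∀ a b y z : Fin 4, ∑ r, c r * M a z r * N b y r =
      (if (a ≠ b ∧ a ≠ y ∧ a ≠ z ∧ b ≠ y ∧ b ≠ z ∧ y ≠ z) then (1 / 2 : K) else 0) -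
      ρ * ((Pi.single a 1 : Fin 4 → K) 0 * (Pi.single y 1 : Fin 4 → K) 1 +
        (Pi.single a 1 : Fin 4 → K) 1 * (Pi.single y 1 : Fin 4 → K) 0) *
      ((Pi.single b 1 : Fin 4 → K) 2 * (Pi.single z 1 : Fin 4 → K) 3 +
        (Pi.single b 1 : Fin 4 → K) 3 * (Pi.single z 1 : Fin 4 → K) 2) * lam)
    (hMv0 : ∀ a z : Fin 4, ∑ r, c r * M a z r * v₀ r = 0)
    (hMv0' : ∀ a z : Fin 4, ∑ r, c r * M a z r * v₀' r = 0)
    (hv0N : ∀ b y : Fin 4, ∑ r, c r * v₀ r * N b y r = 0)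
    (hv0'N : ∀ b y : Fin 4, ∑ r, c r * v₀' r * N b y r = 0)
    (hv0v0 : ∑ r, c r * v₀ r * v₀ r = 0) (hv0'v0' : ∑ r, c r * v₀' r * v₀' r = 0)
    (hv0v0' : ∑ r, c r * v₀ r * v₀' r = lam) (hv0'v0 : ∑ r, c r * v₀' r * v₀ r = lam)
    (hρ : ρ ≠ 0) (hlam : lam ≠ 0) :
    LinearIndependent K (![N 2 0, N 0 2, N 2 1, N 1 2, N 3 0, N 0 3, N 3 1, N 1 3, N 0 1, N 2 3, v₀, v₀'] : Fin 12 → κ → K) := by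
  classical
  rw [Fintype.linearIndependent_iff]
  intro g hg
  have key : ∀ τ : κ → K, ∑ j, g j * ∑ r, c r * τ r * (![N 2 0, N 0 2, N 2 1, N 1 2, N 3 0, N 0 3, N 3 1, N 1 3, N 0 1, N 2 3, v₀, v₀'] : Fin 12 → κ → K) j r = 0 := by
    intro τ
    have e : ∑ j, g j * ∑ r, c r * τ r * (![N 2 0, N 0 2, N 2 1, N 1 2, N 3 0, N 0 3, N 3 1, N 1 3, N 0 1, N 2 3, v₀, v₀'] : Fin 12 → κ → K) j r =
        ∑ r, c r * τ r * (∑ j, g j • (![N 2 0, N 0 2, N 2 1, N 1 2, N 3 0, N 0 3, N 3 1, N 1 3, N 0 1, N 2 3, v₀, v₀'] : Fin 12 → κ → K) j) r := by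
      simp only [Finset.sum_apply, Pi.smul_apply, smul_eq_mul, Finset.mul_sum]
      rw [Finset.sum_comm]
      exact Finset.sum_congr rfl fun r _ => Finset.sum_congr rfl fun j _ => by ring
    rw [e, hg]
    simp
  have T01 : g 9 = 0 := by
    have h := key (M 0 1)
    simpa [Fin.sum_univ_succ, Matrix.cons_val_zero, Matrix.cons_val_succ, hMN, hMv0, hMv0', hρ,
      hlam] using h
  have T02 : g 6 * ((1 / 2 : K) + (-(ρ * lam))) + g 7 * ((1 / 2 : K)) = 0 := by
    have h := key (M 0 2)
    simp [Fin.sum_univ_succ, Matrix.cons_val_zero, Matrix.cons_val_succ, hMN, hMv0, hMv0',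
      -mul_eq_zero] at h
    linear_combination h
  have T03 : g 2 * ((1 / 2 : K) + (-(ρ * lam))) + g 3 * ((1 / 2 : K)) = 0 := by
    have h := key (M 0 3)
    simp [Fin.sum_univ_succ, Matrix.cons_val_zero, Matrix.cons_val_succ, hMN, hMv0, hMv0',
      -mul_eq_zero] at h
    linear_combination h
  have T12 : g 4 * ((1 / 2 : K) + (-(ρ * lam))) + g 5 * ((1 / 2 : K)) = 0 := by
    have h := key (M 1 2)
    simp [Fin.sum_univ_succ, Matrix.cons_val_zero, Matrix.cons_val_succ, hMN, hMv0, hMv0',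
      -mul_eq_zero] at h
    linear_combination h
  have T13 : g 0 * ((1 / 2 : K) + (-(ρ * lam))) + g 1 * ((1 / 2 : K)) = 0 := by
    have h := key (M 1 3)
    simp [Fin.sum_univ_succ, Matrix.cons_val_zero, Matrix.cons_val_succ, hMN, hMv0, hMv0',
      -mul_eq_zero] at h
    linear_combination h
  have T20 : g 6 * ((1 / 2 : K)) + g 7 * ((1 / 2 : K)) = 0 := by
    have h := key (M 2 0)
    simp [Fin.sum_univ_succ, Matrix.cons_val_zero, Matrix.cons_val_succ, hMN, hMv0, hMv0',
      -mul_eq_zero] at h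
    linear_combination h
  have T21 : g 4 * ((1 / 2 : K)) + g 5 * ((1 / 2 : K)) = 0 := by
    have h := key (M 2 1)
    simp [Fin.sum_univ_succ, Matrix.cons_val_zero, Matrix.cons_val_succ, hMN, hMv0, hMv0',
      -mul_eq_zero] at h
    linear_combination h
  have T23 : g 8 = 0 := by
    have h := key (M 2 3)
    simpa [Fin.sum_univ_succ, Matrix.cons_val_zero, Matrix.cons_val_succ, hMN, hMv0, hMv0', hρ,
      hlam] using h
  have T30 : g 2 * ((1 / 2 : K)) + g 3 * ((1 / 2 : K)) = 0 := by
    have h := key (M 3 0)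
    simp [Fin.sum_univ_succ, Matrix.cons_val_zero, Matrix.cons_val_succ, hMN, hMv0, hMv0',
      -mul_eq_zero] at h
    linear_combination h
  have T31 : g 0 * ((1 / 2 : K)) + g 1 * ((1 / 2 : K)) = 0 := by
    have h := key (M 3 1)
    simp [Fin.sum_univ_succ, Matrix.cons_val_zero, Matrix.cons_val_succ, hMN, hMv0, hMv0',
      -mul_eq_zero] at h
    linear_combination h
  have Tv0p : g 10 = 0 := by
    have h := key v₀'
    simpa [Fin.sum_univ_succ, Matrix.cons_val_zero, Matrix.cons_val_succ, hv0'N, hv0'v0, hv0'v0',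
      hlam] using h
  have Tv0 : g 11 = 0 := by
    have h := key v₀
    simpa [Fin.sum_univ_succ, Matrix.cons_val_zero, Matrix.cons_val_succ, hv0N, hv0v0, hv0v0',
      hlam] using h
  have hg10 : g 10 = 0 := Tv0p
  have hg11 : g 11 = 0 := Tv0
  have hg9 : g 9 = 0 := T01
  have hg8 : g 8 = 0 := T23
  have hg6 : g 6 = 0 := by
    have h : g 6 * (ρ * lam) = 0 := by linear_combination (((-1) : K)) * T02 + ((1 : K)) * T20
    exact (mul_eq_zero.1 h).resolve_right (mul_ne_zero hρ hlam)
  have hg7 : g 7 = 0 := by linear_combination ((2 : K)) * T02 + (((-1) : K) + ((2 : K) * (ρ * lam))) * hg6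
  have hg2 : g 2 = 0 := by
    have h : g 2 * (ρ * lam) = 0 := by linear_combination (((-1) : K)) * T03 + ((1 : K)) * T30
    exact (mul_eq_zero.1 h).resolve_right (mul_ne_zero hρ hlam)
  have hg3 : g 3 = 0 := by linear_combination ((2 : K)) * T03 + (((-1) : K) + ((2 : K) * (ρ * lam))) * hg2
  have hg4 : g 4 = 0 := by
    have h : g 4 * (ρ * lam) = 0 := by linear_combination (((-1) : K)) * T12 + ((1 : K)) * T21
    exact (mul_eq_zero.1 h).resolve_right (mul_ne_zero hρ hlam)
  have hg5 : g 5 = 0 := by linear_combination ((2 : K)) * T12 + (((-1) : K) + ((2 : K) * (ρ * lam))) * hg4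
  have hg0 : g 0 = 0 := by
    have h : g 0 * (ρ * lam) = 0 := by linear_combination (((-1) : K)) * T13 + ((1 : K)) * T31
    exact (mul_eq_zero.1 h).resolve_right (mul_ne_zero hρ hlam)
  have hg1 : g 1 = 0 := by linear_combination ((2 : K)) * T13 + (((-1) : K) + ((2 : K) * (ρ * lam))) * hg0
  intro i
  fin_cases i <;> assumption

/-- **Twelve independent vectors** for the corner `ψ = u₀·S₀₁`, `ψ' = u₁·S_{02}`
(memo §1): the ten `N`'s `N00, N21, N01, N20, N10, N02, N03, N12, N13, N23` together with `v₀, v₀'`, by the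
pairing pattern against the `M`'s, `v₀'` and `v₀` (cross pairings `½[a,b,y,z distinct] − ρ·S₀₁[a,y]·S_{02}[b,z]·λ`).
[folklore] -/
theorem linearIndependent_twelve_swap02 [CharZero K] {κ : Type v} [Fintype κ] [DecidableEq κ]
    (c : κ → K) (N M : Fin 4 → Fin 4 → κ → K) (v₀ v₀' : κ → K) (ρ lam : K)
    (hMN : ∀ a b y z : Fin 4, ∑ r, c r * M a z r * N b y r =
      (if (a ≠ b ∧ a ≠ y ∧ a ≠ z ∧ b ≠ y ∧ b ≠ z ∧ y ≠ z) then (1 / 2 : K) else 0) -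
      ρ * ((Pi.single a 1 : Fin 4 → K) 0 * (Pi.single y 1 : Fin 4 → K) 1 +
        (Pi.single a 1 : Fin 4 → K) 1 * (Pi.single y 1 : Fin 4 → K) 0) *
      ((Pi.single b 1 : Fin 4 → K) 0 * (Pi.single z 1 : Fin 4 → K) 2 +
        (Pi.single b 1 : Fin 4 → K) 2 * (Pi.single z 1 : Fin 4 → K) 0) * lam)
    (hMv0 : ∀ a z : Fin 4, ∑ r, c r * M a z r * v₀ r = 0)
    (hMv0' : ∀ a z : Fin 4, ∑ r, c r * M a z r * v₀' r = 0)
    (hv0N : ∀ b y : Fin 4, ∑ r, c r * v₀ r * N b y r = 0)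
    (hv0'N : ∀ b y : Fin 4, ∑ r, c r * v₀' r * N b y r = 0)
    (hv0v0 : ∑ r, c r * v₀ r * v₀ r = 0) (hv0'v0' : ∑ r, c r * v₀' r * v₀' r = 0)
    (hv0v0' : ∑ r, c r * v₀ r * v₀' r = lam) (hv0'v0 : ∑ r, c r * v₀' r * v₀ r = lam)
    (hρ : ρ ≠ 0) (hlam : lam ≠ 0) :
    LinearIndependent K (![N 0 0, N 2 1, N 0 1, N 2 0, N 1 0, N 0 2, N 0 3, N 1 2, N 1 3, N 2 3, v₀, v₀'] : Fin 12 → κ → K) := by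
  classical
  rw [Fintype.linearIndependent_iff]
  intro g hg
  have key : ∀ τ : κ → K, ∑ j, g j * ∑ r, c r * τ r * (![N 0 0, N 2 1, N 0 1, N 2 0, N 1 0, N 0 2, N 0 3, N 1 2, N 1 3, N 2 3, v₀, v₀'] : Fin 12 → κ → K) j r = 0 := by
    intro τ
    have e : ∑ j, g j * ∑ r, c r * τ r * (![N 0 0, N 2 1, N 0 1, N 2 0, N 1 0, N 0 2, N 0 3, N 1 2, N 1 3, N 2 3, v₀, v₀'] : Fin 12 → κ → K) j r =
        ∑ r, c r * τ r * (∑ j, g j • (![N 0 0, N 2 1, N 0 1, N 2 0, N 1 0, N 0 2, N 0 3, N 1 2, N 1 3, N 2 3, v₀, v₀'] : Fin 12 → κ → K) j) r := by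
      simp only [Finset.sum_apply, Pi.smul_apply, smul_eq_mul, Finset.mul_sum]
      rw [Finset.sum_comm]
      exact Finset.sum_congr rfl fun r _ => Finset.sum_congr rfl fun j _ => by ring
    rw [e, hg]
    simp
  have T00 : g 1 = 0 := by
    have h := key (M 0 0)
    simpa [Fin.sum_univ_succ, Matrix.cons_val_zero, Matrix.cons_val_succ, hMN, hMv0, hMv0', hρ,
      hlam] using h
  have T01 : g 9 = 0 := by
    have h := key (M 0 1)
    simpa [Fin.sum_univ_succ, Matrix.cons_val_zero, Matrix.cons_val_succ, hMN, hMv0, hMv0', hρ,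
      hlam] using h
  have T02 : g 2 * ((-(ρ * lam))) + g 8 * ((1 / 2 : K)) = 0 := by
    have h := key (M 0 2)
    simp [Fin.sum_univ_succ, Matrix.cons_val_zero, Matrix.cons_val_succ, hMN, hMv0, hMv0',
      -mul_eq_zero] at h
    linear_combination h
  have T03 : g 1 * ((1 / 2 : K)) + g 7 * ((1 / 2 : K)) = 0 := by
    have h := key (M 0 3)
    simp [Fin.sum_univ_succ, Matrix.cons_val_zero, Matrix.cons_val_succ, hMN, hMv0, hMv0',
      -mul_eq_zero] at h
    linear_combination h
  have T10 : g 3 * ((-(ρ * lam))) + g 9 * ((1 / 2 : K)) = 0 := by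
    have h := key (M 1 0)
    simp [Fin.sum_univ_succ, Matrix.cons_val_zero, Matrix.cons_val_succ, hMN, hMv0, hMv0',
      -mul_eq_zero] at h
    linear_combination h
  have T12 : g 0 * ((-(ρ * lam))) + g 6 * ((1 / 2 : K)) = 0 := by
    have h := key (M 1 2)
    simp [Fin.sum_univ_succ, Matrix.cons_val_zero, Matrix.cons_val_succ, hMN, hMv0, hMv0',
      -mul_eq_zero] at h
    linear_combination h
  have T13 : g 3 * ((1 / 2 : K)) + g 5 * ((1 / 2 : K)) = 0 := by
    have h := key (M 1 3)
    simp [Fin.sum_univ_succ, Matrix.cons_val_zero, Matrix.cons_val_succ, hMN, hMv0, hMv0',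
      -mul_eq_zero] at h
    linear_combination h
  have T20 : g 8 = 0 := by
    have h := key (M 2 0)
    simpa [Fin.sum_univ_succ, Matrix.cons_val_zero, Matrix.cons_val_succ, hMN, hMv0, hMv0', hρ,
      hlam] using h
  have T21 : g 6 = 0 := by
    have h := key (M 2 1)
    simpa [Fin.sum_univ_succ, Matrix.cons_val_zero, Matrix.cons_val_succ, hMN, hMv0, hMv0', hρ,
      hlam] using h
  have T23 : g 2 * ((1 / 2 : K)) + g 4 * ((1 / 2 : K)) = 0 := by
    have h := key (M 2 3)
    simp [Fin.sum_univ_succ, Matrix.cons_val_zero, Matrix.cons_val_succ, hMN, hMv0, hMv0',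
      -mul_eq_zero] at h
    linear_combination h
  have Tv0p : g 10 = 0 := by
    have h := key v₀'
    simpa [Fin.sum_univ_succ, Matrix.cons_val_zero, Matrix.cons_val_succ, hv0'N, hv0'v0, hv0'v0',
      hlam] using h
  have Tv0 : g 11 = 0 := by
    have h := key v₀
    simpa [Fin.sum_univ_succ, Matrix.cons_val_zero, Matrix.cons_val_succ, hv0N, hv0v0, hv0v0',
      hlam] using h
  have hg10 : g 10 = 0 := Tv0p
  have hg11 : g 11 = 0 := Tv0
  have hg1 : g 1 = 0 := T00
  have hg9 : g 9 = 0 := T01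
  have hg7 : g 7 = 0 := by linear_combination ((2 : K)) * T03 + (((-1) : K)) * hg1
  have hg3 : g 3 = 0 := by
    have h : g 3 * (ρ * lam) = 0 := by linear_combination (((-1) : K)) * T10 + ((1 / 2 : K)) * hg9
    exact (mul_eq_zero.1 h).resolve_right (mul_ne_zero hρ hlam)
  have hg5 : g 5 = 0 := by linear_combination ((2 : K)) * T13 + (((-1) : K)) * hg3
  have hg8 : g 8 = 0 := T20
  have hg2 : g 2 = 0 := by
    have h : g 2 * (ρ * lam) = 0 := by linear_combination (((-1) : K)) * T02 + ((1 / 2 : K)) * hg8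
    exact (mul_eq_zero.1 h).resolve_right (mul_ne_zero hρ hlam)
  have hg6 : g 6 = 0 := T21
  have hg0 : g 0 = 0 := by
    have h : g 0 * (ρ * lam) = 0 := by linear_combination (((-1) : K)) * T12 + ((1 / 2 : K)) * hg6
    exact (mul_eq_zero.1 h).resolve_right (mul_ne_zero hρ hlam)
  have hg4 : g 4 = 0 := by linear_combination ((2 : K)) * T23 + (((-1) : K)) * hg2
  intro i
  fin_cases i <;> assumption

end Summit.ValiantsHypothesis.ValiantsHypothesis.Theorems.SymPencilPerFourPeeledCornerSwapPairsVectors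

end
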